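import Summits.QuantumFields.YangMills.Theses.PoincareLipschitz
import Summits.QuantumFields.YangMills.Theorems.PoincareLipschitzTwoSidedOfConcentrationStep
import Summits.QuantumFields.YangMills.Theorems.PoincareLipschitzTwoSidedOfConcentrationCounting
import Summits.QuantumFields.YangMills.Theorems.PoincareLipschitzTwoSidedOfConcentrationBudget
import Summits.QuantumFields.YangMills.Theorems.UnitScaleTiltHistoryTailBoundedHeightLocal
import HarnessLib

/-!
# Route `PoincareLipschitz` (planner ym-r3-idea-2 g7, LINE 15): the glue `TwoSidedOfConcentration` (stmt-QuantumFields-23535) — BY NAME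

`MesoscopicConcentrationL → BlockLipschitzL → BlockLocalityL → MeanDeviationL → FibreConvexityTail.TwoSidedTailL ∧ FibreConvexityTail.TowerTailL`.

THE ARGUMENT (the planner's plan, with the level-`0` input made explicit).  For `1 ≤ j ≤ K − 2` and a level-`j` plaquette `a` of the `K`-th
approximation let `G(a,j)` be the LOCAL GOOD SET: every averaged plaquette `q` of a finer level `i < j` whose finest-lattice corner is within
`64L^j − 64L^i` of the corner of `a` is `θ(K−i)`-small (the hypothesis of `BlockLipschitzL`).  By strong induction on `j` (cut-off `K` fixed)
we prove the LOCAL WINDOW TAIL `Gibbs_K({θ(K−j) ≤ dist1(Ū^j(∂a))} ∩ G(a,j)) ≤ Cc·exp(−c₁·p(g_{K−j})²)`, `c₁ = cc/(4624(CL+1)²)`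
(`local_tail`): the one-height step (`TwoSidedOfConcentration.local_step`: McShane extension + concentration + the mean bound) needs only
`Gibbs_K(G(a,j)ᶜ) ≤ 1/4`, and `G(a,j)ᶜ` is covered by the events `{θ(K−i) ≤ dist1(Ū^i(∂q))} ∩ G(q,i)` of the `≤ 9·129³·L^{3(j−i)}` near plaquettes
`q` of the finer levels (`compl_localGood_subset`, `card_near_le_real`) — bounded by the induction hypothesis for `1 ≤ i < j` and, AT THE FINEST
LEVEL `i = 0`, by the tree's volume-uniform chessboard tail `HistoryTailBoundedHeightLocal.perPlaquette_boundedHeight_uniform L 0`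
(`≤ C₀·β_K⁵·exp(−c₀ p(g_K)²)`); the scalar budget `localGood_budget` makes the total `≤ 1/4` for `γ ≤ γ_A`.  Both route targets are sub-events of
`{θ(K−j) ≤ dist1(Ū^j(∂a))} ∩ G(a,j)` (global smallness of the finer levels implies local smallness; the conditioner constituent is dropped), so
`TwoSidedTailL` and `TowerTailL` follow with `bmin = 0`, `(C, A, c) = (Cc, 0, c₁)`, `γ₁ = min(γ_C, γ_Lip, γ_M, γ_A, ½)`.  The hypothesis
`BlockLocalityL` is not needed (the extension is box-local by construction).

Width seat ym-line-sfw-p2-w3 g30 (cell ym-idea-1, R3 family; free hands), `--workitem stmt-QuantumFields-23535`.  This is route GLUE: the cruxes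
`MesoscopicConcentrationL` (stmt-23532), `BlockLipschitzL` (stmt-23533), `MeanDeviationL` (stmt-23083) stay OPEN; no crux, rung (R3 =
`YM3TorusSU2` is a RECORD rung) or summit is proved; the Yang–Mills mass gap is NOT proved.
-/

set_option autoImplicit false

namespace Summit.QuantumFields.YangMills.Theorems.PoincareLipschitz

open MeasureTheory
open scoped BigOperators
open Literature.MathematicalPhysics.QuantumFieldTheory.Balaban1983to89
open Literature.MathematicalPhysics.QuantumFieldTheory.Balaban1983to89.T3ContinuumYM3Torus
open Literature.MathematicalPhysics.QuantumFieldTheory.Balaban1983to89.T3UnitScaleTilt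
open Literature.MathematicalPhysics.QuantumFieldTheory.Balaban1983to89.T3UnitLawDensityEML (ℰp measurableE_ℰp)
open Summit.QuantumFields.YangMills.Theorems.HistoryTailBoundedHeightLocal (perPlaquette_boundedHeight_uniform)
open Summit.QuantumFields.YangMills.Theorems.PoincareLipschitz.TwoSidedOfConcentration
  (local_step compl_localGood_subset card_near_le_real localGood_budget)

/-- **THE LOCAL WINDOW TAIL BY INDUCTION ON THE HEIGHT.**  From `MesoscopicConcentrationL`, `BlockLipschitzL` and `MeanDeviationL`: for every
`L`, `b₀ > 0`, `p₀ > 2` there are `γ₁ ∈ (0,1]`, `C ≥ 0`, `c > 0` such that for every family `F` with `F.L = L`, every `0 < γ ≤ γ₁`, all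
`1 ≤ j ≤ K − 2` and every level-`j` plaquette `a`:
`Gibbs_K({θ(K−j) ≤ dist1(Ū^j(∂a))} ∩ G(a,j)) ≤ C·exp(−c·p(g_{K−j})²)` (`G(a,j)` the local good set; `(C, c) = (Cc, cc/(4624(CL+1)²))`).
[cite: Balaban1985UV3, (7) p.257 and (71) p.273] -/
theorem local_tail (hC : Summit.QuantumFields.YangMills.Theses.PoincareLipschitz.MesoscopicConcentrationL)
    (hLip : Summit.QuantumFields.YangMills.Theses.PoincareLipschitz.BlockLipschitzL)
    (hM : Summit.QuantumFields.YangMills.Theses.PoincareLipschitz.MeanDeviationL)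
    (L : ℕ) {b₀ p₀ : ℝ} (hb₀ : 0 < b₀) (hp₀ : 2 < p₀) :
    ∃ (γ₁ C c : ℝ), 0 < γ₁ ∧ γ₁ ≤ 1 ∧ 0 ≤ C ∧ 0 < c ∧ ∀ (F : T3Family) (γ : ℝ), F.L = L → 0 < γ → γ ≤ γ₁ →
      ∀ (K j : ℕ), 1 ≤ j → j + 2 ≤ K → ∀ a : Plaq (F.P K) j,
        (gibbsK F ℰp γ K).real ({U : GaugeField (F.P K) 0 (Matrix.specialUnitaryGroup (Fin 2) ℂ) | θBal F.L γ b₀ p₀ (K - j) ≤ GaugeGroup.dist1 (GaugeField.plaqHol (Averaging.iter (fun i' => BlockAveraging.blockAvg (P := F.P K) (j := i') ℰp) j U) a)} ∩ {U : GaugeField (F.P K) 0 (Matrix.specialUnitaryGroup (Fin 2) ℂ) | (∀ (i : ℕ) (q : Plaq (F.P K) i), i < j → Site.tdist (fun k => ((((q.src k).val * F.L ^ i : ℕ)) : ZMod ((F.P K).sitesPerDir 0))) (fun k => ((((a.src k).val * F.L ^ j : ℕ)) : ZMod ((F.P K).sitesPerDir 0))) + 64 * F.L ^ i ≤ 64 *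 F.L ^ j → GaugeGroup.dist1 (GaugeField.plaqHol (Averaging.iter (fun i' => BlockAveraging.blockAvg (P := F.P K) (j := i') ℰp) i U) q) < θBal F.L γ b₀ p₀ (K - i))}) ≤
          C * Real.exp (-(c * B10.pFun b₀ p₀ (Real.sqrt (γ * ((F.L : ℝ)⁻¹) ^ (K - j))) ^ 2)) := by
  -- the constants of the three hypotheses and of the level-0 input
  obtain ⟨Cc, cc, hCc, hcc, γC, hγC, hγC1, HC⟩ := hC L
  obtain ⟨CL, hCL, HLip⟩ := hLip L
  obtain ⟨γLip, hγLip, hγLip1, HLip'⟩ := HLip b₀ p₀ hb₀ hp₀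
  obtain ⟨γM, hγM, hγM1, HM⟩ := hM L b₀ p₀ hb₀ hp₀
  obtain ⟨C₀, c₀, hC₀, hc₀, H0⟩ := perPlaquette_boundedHeight_uniform L 0
  -- degenerate block size: no family has `F.L = L < 2`
  by_cases hL : 2 ≤ L
  swap
  · refine ⟨1, 0, 1, one_pos, le_rfl, le_rfl, one_pos, fun F γ hFL => ?_⟩
    exact absurd (hFL ▸ F.hL.2) (by omega)
  set c₁ : ℝ := cc / (4624 * (CL + 1) ^ 2) with hc₁
  have hc₁pos : 0 < c₁ := by positivity
  obtain ⟨γA, hγA, hγA1, HA⟩ := localGood_budget hL hb₀ (by linarith : (1 : ℝ) ≤ p₀)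
    (by norm_num : (0 : ℝ) ≤ 9 * 129 ^ 3) hC₀ hc₀ hCc hc₁pos
  refine ⟨min γC (min γLip (min γM (min γA (1 / 2)))), Cc, c₁, by positivity, (min_le_left _ _).trans hγC1, hCc, hc₁pos,
    fun F γ hFL hγ hγle K => ?_⟩
  have hγC' : γ ≤ γC := hγle.trans (min_le_left _ _)
  have hγLip' : γ ≤ γLip := hγle.trans ((min_le_right _ _).trans (min_le_left _ _))
  have hγM' : γ ≤ γM := hγle.trans ((min_le_right _ _).trans ((min_le_right _ _).trans (min_le_left _ _)))
  have hγA' : γ ≤ γA :=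
    hγle.trans ((min_le_right _ _).trans ((min_le_right _ _).trans ((min_le_right _ _).trans (min_le_left _ _))))
  have hγ2 : γ ≤ 1 / 2 :=
    hγle.trans ((min_le_right _ _).trans ((min_le_right _ _).trans ((min_le_right _ _).trans (min_le_right _ _))))
  have hγ1 : γ ≤ 1 := by linarith
  subst hFL
  haveI := isProbabilityMeasure_gibbsK F ℰp hγ.le K
  have hβ : (F.scheme ℰp γ).β K = (γ * ((F.L : ℝ)⁻¹) ^ K)⁻¹ := rfl
  -- strong induction on the level `j`
  intro j
  induction j using Nat.strong_induction_on with
  | _ j ih =>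
  intro hj hjK a
  -- the complement of the local good set is rare
  have hGc : (gibbsK F ℰp γ K).real {U : GaugeField (F.P K) 0 (Matrix.specialUnitaryGroup (Fin 2) ℂ) | (∀ (i : ℕ) (q : Plaq (F.P K) i), i < j → Site.tdist (fun k => ((((q.src k).val * F.L ^ i : ℕ)) : ZMod ((F.P K).sitesPerDir 0))) (fun k => ((((a.src k).val * F.L ^ j : ℕ)) : ZMod ((F.P K).sitesPerDir 0))) + 64 * F.L ^ i ≤ 64 * F.L ^ j → GaugeGroup.dist1 (GaugeField.plaqHol (Averaging.iter (fun i' => BlockAveraging.blockAvg (P := F.P K) (j := i') ℰp) i U) q) < θBal F.L γ b₀ p₀ (K - i))}ᶜ ≤ 1 / 4 := by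
    have hcov := compl_localGood_subset F (X := GaugeField (F.P K) 0 (Matrix.specialUnitaryGroup (Fin 2) ℂ)) K j a
      (fun i q U => GaugeGroup.dist1 (GaugeField.plaqHol (Averaging.iter (fun i' => BlockAveraging.blockAvg (P := F.P K) (j := i') ℰp) i U) q)) (fun i => θBal F.L γ b₀ p₀ (K - i))
    beta_reduce at hcov
    -- level 0: the tree's volume-uniform finest-level tail
    have h0 : ∀ q : Plaq (F.P K) 0, (gibbsK F ℰp γ K).real ({U : GaugeField (F.P K) 0 (Matrix.specialUnitaryGroup (Fin 2) ℂ) | θBal F.L γ b₀ p₀ (K - 0) ≤ GaugeGroup.dist1 (GaugeField.plaqHol (Averaging.iter (fun i' => BlockAveraging.blockAvg (P := F.P K) (j := i') ℰp) 0 U) q)} ∩ {U : GaugeField (F.P K) 0 (Matrix.specialUnitaryGroup (Fin 2) ℂ) | (∀ (i' : ℕ) (q' : Plaq (F.P K) i'), i' < 0 → Site.tdist (fun k => ((((q'.src k).val * F.L ^ i' : ℕ)) : ZMod ((F.P K).sitesPerDir 0))) (fun k => ((((q.src k).val * F.L ^ 0 : ℕ)) : ZMod ((F.P K).sitesPerDir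 0))) + 64 * F.L ^ i' ≤ 64 * F.L ^ 0 → GaugeGroup.dist1 (GaugeField.plaqHol (Averaging.iter (fun i' => BlockAveraging.blockAvg (P := F.P K) (j := i') ℰp) i' U) q') < θBal F.L γ b₀ p₀ (K - i'))}) ≤
        C₀ * ((γ * ((F.L : ℝ)⁻¹) ^ K)⁻¹) ^ 5 * Real.exp (-(c₀ * B10.pFun b₀ p₀ (Real.sqrt (γ * ((F.L : ℝ)⁻¹) ^ (K))) ^ 2)) := by
      intro q
      have h := H0 F rfl γ hγ hγ1 b₀ hb₀.le p₀ K 0 (Nat.zero_le K) le_rfl q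
      simp only [Nat.sub_zero] at h
      rw [hβ] at h
      exact (measureReal_mono Set.inter_subset_left (measure_ne_top _ _)).trans h
    -- levels `1 ≤ i < j`: the induction hypothesis
    have hi : ∀ i ∈ Finset.Ico 1 j, ∀ q : Plaq (F.P K) i, (gibbsK F ℰp γ K).real ({U : GaugeField (F.P K) 0 (Matrix.specialUnitaryGroup (Fin 2) ℂ) | θBal F.L γ b₀ p₀ (K - i) ≤ GaugeGroup.dist1 (GaugeField.plaqHol (Averaging.iter (fun i' => BlockAveraging.blockAvg (P := F.P K) (j := i') ℰp) i U) q)} ∩ {U : GaugeField (F.P K) 0 (Matrix.specialUnitaryGroup (Fin 2) ℂ) | (∀ (i' : ℕ) (q' : Plaq (F.P K) i'), i' < i → Site.tdist (fun k => ((((q'.src k).val * F.L ^ i' : ℕ)) : ZMod ((F.P K).sitesPerDir 0))) (fun k => ((((q.src k).val * F.L ^ i : ℕ)) : ZMod ((F.P K).sitesPerDir 0))) + 64 * F.L ^ i' ≤ 64 * F.L ^ i → GaugeGroup.dist1 (GaugeField.plaqHol (Averaging.iter (fun i' => BlockAveraging.blockAvg (P := F.P K) (j := i') ℰp) i' U)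 q') < θBal F.L γ b₀ p₀ (K - i'))}) ≤
        Cc * Real.exp (-(c₁ * B10.pFun b₀ p₀ (Real.sqrt (γ * ((F.L : ℝ)⁻¹) ^ (K - i))) ^ 2)) := by
      intro i hi q
      rw [Finset.mem_Ico] at hi
      exact ih i hi.2 hi.1 (by omega) q
    -- the counts
    have hN : ∀ i, i ≤ j → (((Finset.univ.filter fun q : Plaq (F.P K) i => Site.tdist (fun k => ((((q.src k).val * F.L ^ i : ℕ)) : ZMod ((F.P K).sitesPerDir 0))) (fun k => ((((a.src k).val * F.L ^ j : ℕ)) : ZMod ((F.P K).sitesPerDir 0))) + 64 * F.L ^ i ≤ 64 * F.L ^ j)).card : ℝ) ≤ 9 * 129 ^ 3 * ((F.L : ℝ) ^ (j - i)) ^ 3 :=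
      fun i hij => card_near_le_real F hij (by omega) a
    calc (gibbsK F ℰp γ K).real {U : GaugeField (F.P K) 0 (Matrix.specialUnitaryGroup (Fin 2) ℂ) | (∀ (i : ℕ) (q : Plaq (F.P K) i), i < j → Site.tdist (fun k => ((((q.src k).val * F.L ^ i : ℕ)) : ZMod ((F.P K).sitesPerDir 0))) (fun k => ((((a.src k).val * F.L ^ j : ℕ)) : ZMod ((F.P K).sitesPerDir 0))) + 64 * F.L ^ i ≤ 64 * F.L ^ j → GaugeGroup.dist1 (GaugeField.plaqHol (Averaging.iter (fun i' => BlockAveraging.blockAvg (P := F.P K) (j := i') ℰp) i U) q) < θBal F.L γ b₀ p₀ (K - i))}ᶜ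
        ≤ (gibbsK F ℰp γ K).real (⋃ i ∈ Finset.range j, ⋃ q ∈ (Finset.univ.filter fun q : Plaq (F.P K) i => Site.tdist (fun k => ((((q.src k).val * F.L ^ i : ℕ)) : ZMod ((F.P K).sitesPerDir 0))) (fun k => ((((a.src k).val * F.L ^ j : ℕ)) : ZMod ((F.P K).sitesPerDir 0))) + 64 * F.L ^ i ≤ 64 * F.L ^ j), ({U : GaugeField (F.P K) 0 (Matrix.specialUnitaryGroup (Fin 2) ℂ) | θBal F.L γ b₀ p₀ (K - i) ≤ GaugeGroup.dist1 (GaugeField.plaqHol (Averaging.iter (fun i' => BlockAveraging.blockAvg (P := F.P K) (j := i') ℰp) i U) q)} ∩ {U : GaugeField (F.P K) 0 (Matrix.specialUnitaryGroup (Fin 2) ℂ) | (∀ (i' : ℕ) (q' : Plaq (F.P K) i'), i' < i → Site.tdist (fun k => ((((q'.src k).val * F.L ^ i' : ℕ)) : ZMod ((F.P K).sitesPerDir 0))) (fun k => ((((q.src k).val * F.L ^ i : ℕ)) : ZMod ((F.P K).sitesPerDir 0))) + 64 * F.L ^ i' ≤ 64 * F.L ^ i → GaugeGroup.dist1 (GaugeField.plaqHol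 (Averaging.iter (fun i' => BlockAveraging.blockAvg (P := F.P K) (j := i') ℰp) i' U) q') < θBal F.L γ b₀ p₀ (K - i'))})) :=
          measureReal_mono hcov (measure_ne_top _ _)
      _ ≤ ∑ i ∈ Finset.range j, (gibbsK F ℰp γ K).real (⋃ q ∈ (Finset.univ.filter fun q : Plaq (F.P K) i => Site.tdist (fun k => ((((q.src k).val * F.L ^ i : ℕ)) : ZMod ((F.P K).sitesPerDir 0))) (fun k => ((((a.src k).val * F.L ^ j : ℕ)) : ZMod ((F.P K).sitesPerDir 0))) + 64 * F.L ^ i ≤ 64 * F.L ^ j), ({U : GaugeField (F.P K) 0 (Matrix.specialUnitaryGroup (Fin 2) ℂ) | θBal F.L γ b₀ p₀ (K - i) ≤ GaugeGroup.dist1 (GaugeField.plaqHol (Averaging.iter (fun i' => BlockAveraging.blockAvg (P := F.P K) (j := i') ℰp) i U) q)} ∩ {U : GaugeField (F.P K) 0 (Matrix.specialUnitaryGroup (Fin 2) ℂ) | (∀ (i' : ℕ) (q' : Plaq (F.P K) i'), i' < i → Site.tdist (fun k => ((((q'.src k).val * F.L ^ i' : ℕ)) : ZMod ((F.P K).sitesPerDir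 0))) (fun k => ((((q.src k).val * F.L ^ i : ℕ)) : ZMod ((F.P K).sitesPerDir 0))) + 64 * F.L ^ i' ≤ 64 * F.L ^ i → GaugeGroup.dist1 (GaugeField.plaqHol (Averaging.iter (fun i' => BlockAveraging.blockAvg (P := F.P K) (j := i') ℰp) i' U) q') < θBal F.L γ b₀ p₀ (K - i'))})) :=
          measureReal_biUnion_finset_le _ _
      _ ≤ ∑ i ∈ Finset.range j, ∑ q ∈ (Finset.univ.filter fun q : Plaq (F.P K) i => Site.tdist (fun k => ((((q.src k).val * F.L ^ i : ℕ)) : ZMod ((F.P K).sitesPerDir 0))) (fun k => ((((a.src k).val * F.L ^ j : ℕ)) : ZMod ((F.P K).sitesPerDir 0))) + 64 * F.L ^ i ≤ 64 * F.L ^ j), (gibbsK F ℰp γ K).real ({U : GaugeField (F.P K) 0 (Matrix.specialUnitaryGroup (Fin 2) ℂ) | θBal F.L γ b₀ p₀ (K - i) ≤ GaugeGroup.dist1 (GaugeField.plaqHol (Averaging.iter (fun i' => BlockAveraging.blockAvg (P := F.P K) (j := i') ℰp) i U) q)} ∩ {U : GaugeField (F.P K) 0 (Matrix.specialUnitaryGroup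 (Fin 2) ℂ) | (∀ (i' : ℕ) (q' : Plaq (F.P K) i'), i' < i → Site.tdist (fun k => ((((q'.src k).val * F.L ^ i' : ℕ)) : ZMod ((F.P K).sitesPerDir 0))) (fun k => ((((q.src k).val * F.L ^ i : ℕ)) : ZMod ((F.P K).sitesPerDir 0))) + 64 * F.L ^ i' ≤ 64 * F.L ^ i → GaugeGroup.dist1 (GaugeField.plaqHol (Averaging.iter (fun i' => BlockAveraging.blockAvg (P := F.P K) (j := i') ℰp) i' U) q') < θBal F.L γ b₀ p₀ (K - i'))}) :=
          Finset.sum_le_sum fun i _ => measureReal_biUnion_finset_le _ _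
      _ = ∑ q ∈ (Finset.univ.filter fun q : Plaq (F.P K) 0 => Site.tdist (fun k => ((((q.src k).val * F.L ^ 0 : ℕ)) : ZMod ((F.P K).sitesPerDir 0))) (fun k => ((((a.src k).val * F.L ^ j : ℕ)) : ZMod ((F.P K).sitesPerDir 0))) + 64 * F.L ^ 0 ≤ 64 * F.L ^ j), (gibbsK F ℰp γ K).real ({U : GaugeField (F.P K) 0 (Matrix.specialUnitaryGroup (Fin 2) ℂ) | θBal F.L γ b₀ p₀ (K - 0) ≤ GaugeGroup.dist1 (GaugeField.plaqHol (Averaging.iter (fun i' => BlockAveraging.blockAvg (P := F.P K) (j := i') ℰp) 0 U) q)} ∩ {U : GaugeField (F.P K) 0 (Matrix.specialUnitaryGroup (Fin 2) ℂ) | (∀ (i' : ℕ) (q' : Plaq (F.P K) i'), i' < 0 → Site.tdist (fun k => ((((q'.src k).val * F.L ^ i' : ℕ)) : ZMod ((F.P K).sitesPerDir 0))) (fun k => ((((q.src k).val * F.L ^ 0 : ℕ)) : ZMod ((F.P K).sitesPerDir 0))) + 64 * F.L ^ i' ≤ 64 * F.L ^ 0 → GaugeGroup.dist1 (GaugeField.plaqHol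 (Averaging.iter (fun i' => BlockAveraging.blockAvg (P := F.P K) (j := i') ℰp) i' U) q') < θBal F.L γ b₀ p₀ (K - i'))}) +
            ∑ i ∈ Finset.Ico 1 j, ∑ q ∈ (Finset.univ.filter fun q : Plaq (F.P K) i => Site.tdist (fun k => ((((q.src k).val * F.L ^ i : ℕ)) : ZMod ((F.P K).sitesPerDir 0))) (fun k => ((((a.src k).val * F.L ^ j : ℕ)) : ZMod ((F.P K).sitesPerDir 0))) + 64 * F.L ^ i ≤ 64 * F.L ^ j), (gibbsK F ℰp γ K).real ({U : GaugeField (F.P K) 0 (Matrix.specialUnitaryGroup (Fin 2) ℂ) | θBal F.L γ b₀ p₀ (K - i) ≤ GaugeGroup.dist1 (GaugeField.plaqHol (Averaging.iter (fun i' => BlockAveraging.blockAvg (P := F.P K) (j := i') ℰp) i U) q)} ∩ {U : GaugeField (F.P K) 0 (Matrix.specialUnitaryGroup (Fin 2) ℂ) | (∀ (i' : ℕ) (q' : Plaq (F.P K) i'), i' < i → Site.tdist (fun k => ((((q'.src k).val * F.L ^ i' : ℕ)) : ZMod ((F.P K).sitesPerDir 0))) (fun k => ((((q.src k).val * F.L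 ^ i : ℕ)) : ZMod ((F.P K).sitesPerDir 0))) + 64 * F.L ^ i' ≤ 64 * F.L ^ i → GaugeGroup.dist1 (GaugeField.plaqHol (Averaging.iter (fun i' => BlockAveraging.blockAvg (P := F.P K) (j := i') ℰp) i' U) q') < θBal F.L γ b₀ p₀ (K - i'))}) := by
          rw [Finset.range_eq_Ico, Finset.sum_eq_sum_Ico_succ_bot hj]
      _ ≤ 9 * 129 ^ 3 * ((F.L : ℝ) ^ j) ^ 3 * (C₀ * ((γ * ((F.L : ℝ)⁻¹) ^ K)⁻¹) ^ 5 * Real.exp (-(c₀ * B10.pFun b₀ p₀ (Real.sqrt (γ * ((F.L : ℝ)⁻¹) ^ (K))) ^ 2))) +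
            ∑ i ∈ Finset.Ico 1 j, 9 * 129 ^ 3 * ((F.L : ℝ) ^ (j - i)) ^ 3 * (Cc * Real.exp (-(c₁ * B10.pFun b₀ p₀ (Real.sqrt (γ * ((F.L : ℝ)⁻¹) ^ (K - i))) ^ 2))) := by
          refine add_le_add ?_ (Finset.sum_le_sum fun i hi' => ?_)
          · calc ∑ q ∈ (Finset.univ.filter fun q : Plaq (F.P K) 0 => Site.tdist (fun k => ((((q.src k).val * F.L ^ 0 : ℕ)) : ZMod ((F.P K).sitesPerDir 0))) (fun k => ((((a.src k).val * F.L ^ j : ℕ)) : ZMod ((F.P K).sitesPerDir 0))) + 64 * F.L ^ 0 ≤ 64 * F.L ^ j), (gibbsK F ℰp γ K).real ({U : GaugeField (F.P K) 0 (Matrix.specialUnitaryGroup (Fin 2) ℂ) | θBal F.L γ b₀ p₀ (K - 0) ≤ GaugeGroup.dist1 (GaugeField.plaqHol (Averaging.iter (fun i' => BlockAveraging.blockAvg (P := F.P K) (j := i') ℰp) 0 U) q)} ∩ {U : GaugeField (F.P K) 0 (Matrix.specialUnitaryGroup (Fin 2) ℂ) | (∀ (i' : ℕ) (q' : Plaq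 (F.P K) i'), i' < 0 → Site.tdist (fun k => ((((q'.src k).val * F.L ^ i' : ℕ)) : ZMod ((F.P K).sitesPerDir 0))) (fun k => ((((q.src k).val * F.L ^ 0 : ℕ)) : ZMod ((F.P K).sitesPerDir 0))) + 64 * F.L ^ i' ≤ 64 * F.L ^ 0 → GaugeGroup.dist1 (GaugeField.plaqHol (Averaging.iter (fun i' => BlockAveraging.blockAvg (P := F.P K) (j := i') ℰp) i' U) q') < θBal F.L γ b₀ p₀ (K - i'))})
                ≤ ∑ q ∈ (Finset.univ.filter fun q : Plaq (F.P K) 0 => Site.tdist (fun k => ((((q.src k).val * F.L ^ 0 : ℕ)) : ZMod ((F.P K).sitesPerDir 0))) (fun k => ((((a.src k).val * F.L ^ j : ℕ)) : ZMod ((F.P K).sitesPerDir 0))) + 64 * F.L ^ 0 ≤ 64 * F.L ^ j), C₀ * ((γ * ((F.L : ℝ)⁻¹) ^ K)⁻¹) ^ 5 * Real.exp (-(c₀ * B10.pFun b₀ p₀ (Real.sqrt (γ * ((F.L : ℝ)⁻¹) ^ (K))) ^ 2)) :=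
                  Finset.sum_le_sum fun q _ => h0 q
              _ = ((Finset.univ.filter fun q : Plaq (F.P K) 0 => Site.tdist (fun k => ((((q.src k).val * F.L ^ 0 : ℕ)) : ZMod ((F.P K).sitesPerDir 0))) (fun k => ((((a.src k).val * F.L ^ j : ℕ)) : ZMod ((F.P K).sitesPerDir 0))) + 64 * F.L ^ 0 ≤ 64 * F.L ^ j)).card * (C₀ * ((γ * ((F.L : ℝ)⁻¹) ^ K)⁻¹) ^ 5 * Real.exp (-(c₀ * B10.pFun b₀ p₀ (Real.sqrt (γ * ((F.L : ℝ)⁻¹) ^ (K))) ^ 2))) := by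
                  rw [Finset.sum_const, nsmul_eq_mul]
              _ ≤ 9 * 129 ^ 3 * ((F.L : ℝ) ^ j) ^ 3 * (C₀ * ((γ * ((F.L : ℝ)⁻¹) ^ K)⁻¹) ^ 5 * Real.exp (-(c₀ * B10.pFun b₀ p₀ (Real.sqrt (γ * ((F.L : ℝ)⁻¹) ^ (K))) ^ 2))) := by
                  have h := hN 0 (Nat.zero_le j)
                  rw [Nat.sub_zero] at h
                  exact mul_le_mul_of_nonneg_right h (by positivity)
          · calc ∑ q ∈ (Finset.univ.filter fun q : Plaq (F.P K) i => Site.tdist (fun k => ((((q.src k).val * F.L ^ i : ℕ)) : ZMod ((F.P K).sitesPerDir 0))) (fun k => ((((a.src k).val * F.L ^ j : ℕ)) : ZMod ((F.P K).sitesPerDir 0))) + 64 * F.L ^ i ≤ 64 * F.L ^ j), (gibbsK F ℰp γ K).real ({U : GaugeField (F.P K) 0 (Matrix.specialUnitaryGroup (Fin 2) ℂ) | θBal F.L γ b₀ p₀ (K - i) ≤ GaugeGroup.dist1 (GaugeField.plaqHol (Averaging.iter (fun i' => BlockAveraging.blockAvg (P := F.P K) (j := i') ℰp) i U) q)} ∩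 {U : GaugeField (F.P K) 0 (Matrix.specialUnitaryGroup (Fin 2) ℂ) | (∀ (i' : ℕ) (q' : Plaq (F.P K) i'), i' < i → Site.tdist (fun k => ((((q'.src k).val * F.L ^ i' : ℕ)) : ZMod ((F.P K).sitesPerDir 0))) (fun k => ((((q.src k).val * F.L ^ i : ℕ)) : ZMod ((F.P K).sitesPerDir 0))) + 64 * F.L ^ i' ≤ 64 * F.L ^ i → GaugeGroup.dist1 (GaugeField.plaqHol (Averaging.iter (fun i' => BlockAveraging.blockAvg (P := F.P K) (j := i') ℰp) i' U) q') < θBal F.L γ b₀ p₀ (K - i'))})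
                ≤ ∑ q ∈ (Finset.univ.filter fun q : Plaq (F.P K) i => Site.tdist (fun k => ((((q.src k).val * F.L ^ i : ℕ)) : ZMod ((F.P K).sitesPerDir 0))) (fun k => ((((a.src k).val * F.L ^ j : ℕ)) : ZMod ((F.P K).sitesPerDir 0))) + 64 * F.L ^ i ≤ 64 * F.L ^ j), Cc * Real.exp (-(c₁ * B10.pFun b₀ p₀ (Real.sqrt (γ * ((F.L : ℝ)⁻¹) ^ (K - i))) ^ 2)) :=
                  Finset.sum_le_sum fun q _ => hi i hi' q
              _ = ((Finset.univ.filter fun q : Plaq (F.P K) i => Site.tdist (fun k => ((((q.src k).val * F.L ^ i : ℕ)) : ZMod ((F.P K).sitesPerDir 0))) (fun k => ((((a.src k).val * F.L ^ j : ℕ)) : ZMod ((F.P K).sitesPerDir 0))) + 64 * F.L ^ i ≤ 64 * F.L ^ j)).card * (Cc * Real.exp (-(c₁ * B10.pFun b₀ p₀ (Real.sqrt (γ * ((F.L : ℝ)⁻¹) ^ (K - i))) ^ 2))) := by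
                  rw [Finset.sum_const, nsmul_eq_mul]
              _ ≤ 9 * 129 ^ 3 * ((F.L : ℝ) ^ (j - i)) ^ 3 * (Cc * Real.exp (-(c₁ * B10.pFun b₀ p₀ (Real.sqrt (γ * ((F.L : ℝ)⁻¹) ^ (K - i))) ^ 2))) :=
                  mul_le_mul_of_nonneg_right (hN i (Finset.mem_Ico.mp hi').2.le) (by positivity)
      _ ≤ 1 / 4 := HA γ hγ hγA' K j (by omega)
  exact local_step F hγ hγ2 hb₀ hjK a hCL (HC F γ rfl hγ hγC' K) (HLip' F γ rfl hγ hγLip' K j hj hjK a)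
    (HM F γ rfl hγ hγM' K j hj (by omega) a) hGc

/-- ★ **`PoincareLipschitz.TwoSidedOfConcentration`** (item stmt-QuantumFields-23535) BY NAME: `MesoscopicConcentrationL → BlockLipschitzL →
BlockLocalityL → MeanDeviationL → TwoSidedTailL ∧ TowerTailL`.  Both events of route `FibreConvexityTail` are sub-events of the local window
event of `local_tail` (global smallness of the finer levels implies local smallness; the conditioner constituent is dropped); `bmin = 0`,
`A = 0`.  Route glue only: the three cruxes stay open, and nothing about rung R3 or the Yang–Mills mass gap is proved.
[cite: Balaban1985UV3, (7) p.257 and (71) p.273] -/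
theorem twoSidedOfConcentration_proof : Summit.QuantumFields.YangMills.Theses.PoincareLipschitz.TwoSidedOfConcentration := by
  intro hC hLip _hLoc hM
  refine ⟨fun L => ⟨0, fun b₀ p₀ _ hb₀ hp₀ => ?_⟩, fun L => ⟨0, fun b₀ p₀ _ hb₀ hp₀ => ?_⟩⟩
  · obtain ⟨γ₁, C, c, hγ₁, hγ₁1, hC0, hc, H⟩ := local_tail hC hLip hM L hb₀ hp₀
    refine ⟨γ₁, hγ₁, hγ₁1, fun F γ hFL hγ hle => ⟨C, 0, c, hC0, hc, fun K j hj hjK a => ?_⟩⟩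
    haveI := isProbabilityMeasure_gibbsK F ℰp hγ.le K
    have hsub : ({U : GaugeField (F.P K) 0 (Matrix.specialUnitaryGroup (Fin 2) ℂ) | θBal F.L γ b₀ p₀ (K - j) ≤ GaugeGroup.dist1 (GaugeField.plaqHol (Averaging.iter (fun i' => BlockAveraging.blockAvg (P := F.P K) (j := i') ℰp) j U) a)} ∩
          {U : GaugeField (F.P K) 0 (Matrix.specialUnitaryGroup (Fin 2) ℂ) | ∀ i, i < j → PlaqSmall (θBal F.L γ b₀ p₀ (K - i)) (Averaging.iter (fun i' => BlockAveraging.blockAvg (P := F.P K) (j := i') ℰp) i U)} ∩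
          {U : GaugeField (F.P K) 0 (Matrix.specialUnitaryGroup (Fin 2) ℂ) | PlaqSmall (θBal F.L γ b₀ p₀ (K - (j + 2))) (Averaging.iter (fun i' => BlockAveraging.blockAvg (P := F.P K) (j := i') ℰp) (j + 2) U)}) ⊆
        ({U : GaugeField (F.P K) 0 (Matrix.specialUnitaryGroup (Fin 2) ℂ) | θBal F.L γ b₀ p₀ (K - j) ≤ GaugeGroup.dist1 (GaugeField.plaqHol (Averaging.iter (fun i' => BlockAveraging.blockAvg (P := F.P K) (j := i') ℰp) j U) a)} ∩ {U : GaugeField (F.P K) 0 (Matrix.specialUnitaryGroup (Fin 2) ℂ) | (∀ (i : ℕ) (q : Plaq (F.P K) i), i < j → Site.tdist (fun k => ((((q.src k).val * F.L ^ i : ℕ)) : ZMod ((F.P K).sitesPerDir 0))) (fun k => ((((a.src k).val * F.L ^ j : ℕ)) : ZMod ((F.P K).sitesPerDir 0))) + 64 * F.L ^ i ≤ 64 * F.L ^ j → GaugeGroup.dist1 (GaugeField.plaqHol (Averaging.iter (fun i' => BlockAveraging.blockAvg (P := F.P K) (j := i') ℰp) i U) q) < θBal F.L γ b₀ p₀ (K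 - i))}) := by
      rintro U ⟨⟨hU1, hU2⟩, -⟩
      exact ⟨hU1, fun i q hi _ => hU2 i hi q⟩
    calc (gibbsK F ℰp γ K).real ({U : GaugeField (F.P K) 0 (Matrix.specialUnitaryGroup (Fin 2) ℂ) | θBal F.L γ b₀ p₀ (K - j) ≤ GaugeGroup.dist1 (GaugeField.plaqHol (Averaging.iter (fun i' => BlockAveraging.blockAvg (P := F.P K) (j := i') ℰp) j U) a)} ∩
          {U : GaugeField (F.P K) 0 (Matrix.specialUnitaryGroup (Fin 2) ℂ) | ∀ i, i < j → PlaqSmall (θBal F.L γ b₀ p₀ (K - i)) (Averaging.iter (fun i' => BlockAveraging.blockAvg (P := F.P K) (j := i') ℰp) i U)} ∩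
          {U : GaugeField (F.P K) 0 (Matrix.specialUnitaryGroup (Fin 2) ℂ) | PlaqSmall (θBal F.L γ b₀ p₀ (K - (j + 2))) (Averaging.iter (fun i' => BlockAveraging.blockAvg (P := F.P K) (j := i') ℰp) (j + 2) U)})
        ≤ (gibbsK F ℰp γ K).real ({U : GaugeField (F.P K) 0 (Matrix.specialUnitaryGroup (Fin 2) ℂ) | θBal F.L γ b₀ p₀ (K - j) ≤ GaugeGroup.dist1 (GaugeField.plaqHol (Averaging.iter (fun i' => BlockAveraging.blockAvg (P := F.P K) (j := i') ℰp) j U) a)} ∩ {U : GaugeField (F.P K) 0 (Matrix.specialUnitaryGroup (Fin 2) ℂ) | (∀ (i : ℕ) (q : Plaq (F.P K) i), i < j → Site.tdist (fun k => ((((q.src k).val * F.L ^ i : ℕ)) : ZMod ((F.P K).sitesPerDir 0))) (fun k => ((((a.src k).val * F.L ^ j : ℕ)) : ZMod ((F.P K).sitesPerDir 0))) + 64 * F.L ^ i ≤ 64 * F.L ^ j → GaugeGroup.dist1 (GaugeField.plaqHol (Averaging.iter (fun i' => BlockAveraging.blockAvg (P := F.P K) (j := i') ℰp) i U) q) < θBal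 F.L γ b₀ p₀ (K - i))}) :=
          measureReal_mono hsub (measure_ne_top _ _)
      _ ≤ C * Real.exp (-(c * B10.pFun b₀ p₀ (Real.sqrt (γ * ((F.L : ℝ)⁻¹) ^ (K - j))) ^ 2)) := H F γ hFL hγ hle K j hj hjK a
      _ = C * (F.scheme ℰp γ).β (K - j) ^ 0 * Real.exp (-(c * B10.pFun b₀ p₀ (Real.sqrt (γ * ((F.L : ℝ)⁻¹) ^ (K - j))) ^ 2)) := by
          rw [pow_zero, mul_one]
  · obtain ⟨γ₁, C, c, hγ₁, hγ₁1, hC0, hc, H⟩ := local_tail hC hLip hM L hb₀ hp₀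
    refine ⟨γ₁, hγ₁, hγ₁1, fun F γ hFL hγ hle => ⟨C, 0, c, hC0, hc, fun K j hj hjK a => ?_⟩⟩
    haveI := isProbabilityMeasure_gibbsK F ℰp hγ.le K
    have hsub : ({U : GaugeField (F.P K) 0 (Matrix.specialUnitaryGroup (Fin 2) ℂ) | θBal F.L γ b₀ p₀ (K - j) ≤ GaugeGroup.dist1 (GaugeField.plaqHol (Averaging.iter (fun i' => BlockAveraging.blockAvg (P := F.P K) (j := i') ℰp) j U) a)} ∩
          {U : GaugeField (F.P K) 0 (Matrix.specialUnitaryGroup (Fin 2) ℂ) | ∀ i, i < j → PlaqSmall (θBal F.L γ b₀ p₀ (K - i)) (Averaging.iter (fun i' => BlockAveraging.blockAvg (P := F.P K) (j := i') ℰp) i U)} ∩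
          {U : GaugeField (F.P K) 0 (Matrix.specialUnitaryGroup (Fin 2) ℂ) | ¬ PlaqSmall (θBal F.L γ b₀ p₀ (K - (j + 2))) (Averaging.iter (fun i' => BlockAveraging.blockAvg (P := F.P K) (j := i') ℰp) (j + 2) U)}) ⊆
        ({U : GaugeField (F.P K) 0 (Matrix.specialUnitaryGroup (Fin 2) ℂ) | θBal F.L γ b₀ p₀ (K - j) ≤ GaugeGroup.dist1 (GaugeField.plaqHol (Averaging.iter (fun i' => BlockAveraging.blockAvg (P := F.P K) (j := i') ℰp) j U) a)} ∩ {U : GaugeField (F.P K) 0 (Matrix.specialUnitaryGroup (Fin 2) ℂ) | (∀ (i : ℕ) (q : Plaq (F.P K) i), i < j → Site.tdist (fun k => ((((q.src k).val * F.L ^ i : ℕ)) : ZMod ((F.P K).sitesPerDir 0))) (fun k => ((((a.src k).val * F.L ^ j : ℕ)) : ZMod ((F.P K).sitesPerDir 0))) + 64 * F.L ^ i ≤ 64 * F.L ^ j → GaugeGroup.dist1 (GaugeField.plaqHol (Averaging.iter (fun i' => BlockAveraging.blockAvg (P := F.P K) (j := i') ℰp) i U) q) < θBal F.L γ b₀ p₀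 (K - i))}) := by
      rintro U ⟨⟨hU1, hU2⟩, -⟩
      exact ⟨hU1, fun i q hi _ => hU2 i hi q⟩
    calc (gibbsK F ℰp γ K).real ({U : GaugeField (F.P K) 0 (Matrix.specialUnitaryGroup (Fin 2) ℂ) | θBal F.L γ b₀ p₀ (K - j) ≤ GaugeGroup.dist1 (GaugeField.plaqHol (Averaging.iter (fun i' => BlockAveraging.blockAvg (P := F.P K) (j := i') ℰp) j U) a)} ∩
          {U : GaugeField (F.P K) 0 (Matrix.specialUnitaryGroup (Fin 2) ℂ) | ∀ i, i < j → PlaqSmall (θBal F.L γ b₀ p₀ (K - i)) (Averaging.iter (fun i' => BlockAveraging.blockAvg (P := F.P K) (j := i') ℰp) i U)} ∩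
          {U : GaugeField (F.P K) 0 (Matrix.specialUnitaryGroup (Fin 2) ℂ) | ¬ PlaqSmall (θBal F.L γ b₀ p₀ (K - (j + 2))) (Averaging.iter (fun i' => BlockAveraging.blockAvg (P := F.P K) (j := i') ℰp) (j + 2) U)})
        ≤ (gibbsK F ℰp γ K).real ({U : GaugeField (F.P K) 0 (Matrix.specialUnitaryGroup (Fin 2) ℂ) | θBal F.L γ b₀ p₀ (K - j) ≤ GaugeGroup.dist1 (GaugeField.plaqHol (Averaging.iter (fun i' => BlockAveraging.blockAvg (P := F.P K) (j := i') ℰp) j U) a)} ∩ {U : GaugeField (F.P K) 0 (Matrix.specialUnitaryGroup (Fin 2) ℂ) | (∀ (i : ℕ) (q : Plaq (F.P K) i), i < j → Site.tdist (fun k => ((((q.src k).val * F.L ^ i : ℕ)) : ZMod ((F.P K).sitesPerDir 0))) (fun k => ((((a.src k).val * F.L ^ j : ℕ)) : ZMod ((F.P K).sitesPerDir 0))) + 64 * F.L ^ i ≤ 64 * F.L ^ j → GaugeGroup.dist1 (GaugeField.plaqHol (Averaging.iter (fun i' => BlockAveraging.blockAvg (P := F.P K) (j := i') ℰp) i U)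 q) < θBal F.L γ b₀ p₀ (K - i))}) :=
          measureReal_mono hsub (measure_ne_top _ _)
      _ ≤ C * Real.exp (-(c * B10.pFun b₀ p₀ (Real.sqrt (γ * ((F.L : ℝ)⁻¹) ^ (K - j))) ^ 2)) := H F γ hFL hγ hle K j hj hjK a
      _ = C * (F.scheme ℰp γ).β (K - j) ^ 0 * Real.exp (-(c * B10.pFun b₀ p₀ (Real.sqrt (γ * ((F.L : ℝ)⁻¹) ^ (K - j))) ^ 2)) := by
          rw [pow_zero, mul_one]

end Summit.QuantumFields.YangMills.Theorems.PoincareLipschitz
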